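import Summits.KontsevichZagierPeriods.KontsevichZagierPeriods.Theorems.MzvKernelInKZTwoPosetsShuffleProduct
import Summits.KontsevichZagierPeriods.KontsevichZagierPeriods.Theorems.MzvKernelInKZTwoPosetsFurushoBridge
import Summits.KontsevichZagierPeriods.KontsevichZagierPeriods.Theses.FurushoPentagon

/-!
# `DoubleShuffleInKZ` (stmt-KontsevichZagierPeriods-14665, route `FurushoPentagon`): the Λ-poset shuffle cells, lemmas

Helper file (`--supports stmt-KontsevichZagierPeriods-14665`), line "rider lever" for the
Kaneko–Yamamoto integral–series family `IS_j(u)`.  THE INTEGRAL SIDE: the `Λ`-shaped 2-poset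
integral (Kaneko–Yamamoto's `μ(k, (1^j))`; Yamamoto's 2-posets) — a top variable `t₀` carrying
`dt/t`, below it a chain of `j` rider variables carrying `dt/(1−t)` and, independently, the chain
of the remaining letters `ε'` of a convergent word —

  `[Λ, ω] = [{1 > t₀ > v₀ > ⋯ > v_{j-1} > 0, t₀ > s₀ > ⋯ > s_{c-1} > 0}, (1/t₀) ∏ 1/(1−v_a) ∏ ω_{ε'_i}(s_i)]`

EXISTS and dissects, modulo `KZ.relations`, into the simplex classes of its linear extensions:
`[Λ, ω] ≡ Σ_{w ∈ 1ʲ ш ε'} Z(index of 0w)` (`lambda_cells`, sibling file `…LambdaCells.lean`; this file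
holds its coordinate lemmas: the top extension of a permutation of the lower block, canonical word
representations as pinned classes, semialgebraicity of `Λ`).  Exactly as the product dissection
`TwoPosets.stub_shuffleProduct` (whose coordinate lemmas are reused: the cells are the tuples sorted
along a coordinate shuffle `e` of the two chains, extended by the top variable), except that the
rider chain alone carries NO convergent representation — only the coupling `v₀ < t₀` makes `Λ`
integrable — so the dissection is fibred over `t₀`: rule (1a) off the null tie walls `{v_a = s_i}`,
one reindexing (rule (2)) per cell.

References: M. Kontsevich, D. Zagier, *Periods* (2001), §1.2; S. Yamamoto, *Multiple zeta-star
values and multiple integrals*, RIMS Kôkyûroku Bessatsu B68 (2017); M. Kaneko, S. Yamamoto, Selecta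
Math. 24 (2018), Thm 4.1.
-/

noncomputable section

open Set MeasureTheory
open Literature.NumberTheory.Transcendental
open Summit.KontsevichZagierPeriods.MzvKernelInKZ.Negative
open Summit.KontsevichZagierPeriods.MzvKernelInKZ.TwoPosets

namespace Summit.KontsevichZagierPeriods.FurushoPentagon.DoubleShuffleInKZ

/-! ### The top extension of a permutation of the lower block -/

/-- The permutation of `Fin (M + 1)` fixing `0` and acting by `e` on the successors. [folklore] -/
theorem consPerm_apply_zero {M : ℕ} (e : Fin M ≃ Fin M) :
    ((finSuccEquiv M).trans (e.optionCongr.trans (finSuccEquiv M).symm)) 0 = 0 := by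
  simp

/-- The top extension acts by `e` on successors. [folklore] -/
theorem consPerm_apply_succ {M : ℕ} (e : Fin M ≃ Fin M) (p : Fin M) :
    ((finSuccEquiv M).trans (e.optionCongr.trans (finSuccEquiv M).symm)) p.succ = (e p).succ := by
  simp

/-- **Sorted tuples along the top extension**: `z ∘ ê` lies in the open ordered simplex iff
`0 < z₀ < 1`, the lower block read along `e` lies in the simplex, and its largest entry is below
`z₀`. [folklore] -/
theorem comp_consPerm_mem_simplex_iff {M : ℕ} (hM : 0 < M) (e : Fin M ≃ Fin M)
    (z : Fin (M + 1) → ℝ) :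
    (fun k => z (((finSuccEquiv M).trans (e.optionCongr.trans (finSuccEquiv M).symm)) k)) ∈
        simplex (M + 1) ↔
      z 0 ∈ Set.Ioo (0:ℝ) 1 ∧ (fun p => z (e p).succ) ∈ simplex M ∧ z (e ⟨0, hM⟩).succ < z 0 := by
  obtain ⟨M, rfl⟩ : ∃ M', M = M' + 1 := ⟨M - 1, by omega⟩
  have hz0 : (⟨0, hM⟩ : Fin (M + 1)) = 0 := rfl
  rw [hz0]
  set E := (finSuccEquiv (M + 1)).trans (e.optionCongr.trans (finSuccEquiv (M + 1)).symm) with hE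
  have hE0 : E 0 = 0 := consPerm_apply_zero e
  have hEs : ∀ p : Fin (M + 1), E p.succ = (e p).succ := consPerm_apply_succ e
  simp only [simplex, Set.mem_setOf_eq, Fin.strictAnti_iff_succ_lt]
  constructor
  · rintro ⟨hpos, hlt1, hanti⟩
    refine ⟨⟨by simpa [hE0] using hpos 0, by simpa [hE0] using hlt1 0⟩,
      ⟨fun p => by simpa [hEs] using hpos p.succ, fun p => by simpa [hEs] using hlt1 p.succ,
        fun p => ?_⟩, ?_⟩
    · have h := hanti p.succ
      rw [hEs, ← Fin.succ_castSucc, hEs] at h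
      exact h
    · have h := hanti 0
      rw [Fin.succ_zero_eq_one, ← Fin.succ_zero_eq_one, hEs, Fin.castSucc_zero, hE0] at h
      exact h
  · rintro ⟨⟨h0, h1⟩, ⟨hpos, hlt1, hanti⟩, htop⟩
    refine ⟨fun k => ?_, fun k => ?_, fun k => ?_⟩
    · refine Fin.cases ?_ (fun p => ?_) k
      · simpa [hE0] using h0
      · simpa [hEs] using hpos p
    · refine Fin.cases ?_ (fun p => ?_) k
      · simpa [hE0] using h1
      · simpa [hEs] using hlt1 p
    · refine Fin.cases ?_ (fun p => ?_) k
      · rw [hEs, Fin.castSucc_zero, hE0]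
        exact htop
      · rw [hEs, ← Fin.succ_castSucc, hEs]
        exact hanti p

/-! ### Word representations of admissible words are pinned classes -/

/-- `wordOf N (ofFn W) = W`. [folklore] -/
theorem wordOf_ofFn' {N : ℕ} (W : Fin N → Bool) : wordOf N (List.ofFn W) = W := by
  funext i
  simp [wordOf, List.getD_eq_getElem?_getD, i.isLt]

/-- **The canonical representation of an admissible word is the pinned class of its index**:
`[Δ_N, ω_W] = Z(index of W)` for every `Z` pinned to Kontsevich's simplex classes. [folklore] -/
theorem of_wordRep_eq_pinned (Z : List ℕ → KZ.FormalRep)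
    (hZ : ∀ (u : List ℕ) (hu : MZV.IsAdmissible u), Z u = KZ.of (KZ.mzvRep u hu
      (KZ.mzvIntegrand_isSemialgebraicFunOn_holds u) (KZ.mzvIntegrand_integrableOn_holds u hu)))
    {N : ℕ} (hN : 0 < N) (W : Fin N → Bool) (hW : Adm W) :
    KZ.of (wordRep W 1 hW) = Z (MZV.ofBinaryWord (List.ofFn W)) := by
  obtain ⟨s, hs, hws, hbin⟩ := exists_index_of_adm hN W hW
  subst hws
  have hsW : MZV.ofBinaryWord (List.ofFn W) = s := by
    rw [← hbin, MZV.ofBinaryWord_binaryWord hs.1]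
  have hbw : bword (MZV.weight s) s = W := by
    show wordOf (MZV.weight s) (MZV.binaryWord s) = W
    rw [hbin, wordOf_ofFn']
  rw [hsW, hZ s hs, ← zIdx_one_eq_of_mzvRep s hs, zIdx_of_adm hs]
  congr 1
  exact KZ.IntegralRep.ext' (by rw [wordRep_domain, wordRep_domain]) (by rw [wordRep_integrand,
    wordRep_integrand, hbw])

/-! ### The Λ-domain: semialgebraicity, the word integrand off the simplex -/

/-- The word integrand is `ℚ`-semialgebraic on any `ℚ`-semialgebraic set of tuples with
coordinates in `(0,1)` (denominators `tᵢ`, `1 − tᵢ` do not vanish). [folklore] -/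
theorem isSemialgebraicFunOn_wordFun_of_subset {N : ℕ} (ε : Fin N → Bool) {S : Set (Fin N → ℝ)}
    (hS : Literature.ModelTheory.ExponentialFields.IsSemialgebraic ℚ S)
    (hS01 : ∀ t ∈ S, ∀ i, t i ∈ Set.Ioo (0:ℝ) 1) :
    IsSemialgebraicFunOn ℚ S (wordFun ε 1) := by
  refine (isSemialgebraicFunOn_aeval_div_aeval hS (MvPolynomial.C 1) _ fun t ht => ?_).congr
    fun t _ => (wordFun_eq_aeval_div ε 1 t).symm
  rw [map_prod]
  refine Finset.prod_ne_zero_iff.mpr fun i _ => ?_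
  split_ifs
  · simpa [sub_eq_zero] using (hS01 t ht i).2.ne'
  · simpa using (hS01 t ht i).1.ne'

/-- The Λ-domain `{all coordinates in (0,1), riders and chain strictly decreasing, both tops below
`z₀`}` is `ℚ`-semialgebraic. [folklore] -/
theorem isSemialgebraic_lambdaDomain (j c : ℕ) (hj : 0 < j) (hc : 0 < c) :
    Literature.ModelTheory.ExponentialFields.IsSemialgebraic ℚ {z : Fin (j + c + 1) → ℝ |
      (∀ k, z k ∈ Set.Ioo (0:ℝ) 1) ∧
      StrictAnti (fun a : Fin j => z (Fin.castAdd c a).succ) ∧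
      StrictAnti (fun i : Fin c => z (Fin.natAdd j i).succ) ∧
      z (Fin.castAdd c ⟨0, hj⟩).succ < z 0 ∧ z (Fin.natAdd j ⟨0, hc⟩).succ < z 0} := by
  have h1 : Literature.ModelTheory.ExponentialFields.IsSemialgebraic ℚ
      {z : Fin (j + c + 1) → ℝ | ∀ k, z k ∈ Set.Ioo (0:ℝ) 1} := by
    have : {z : Fin (j + c + 1) → ℝ | ∀ k, z k ∈ Set.Ioo (0:ℝ) 1} =
        ⋂ k ∈ (Finset.univ : Finset (Fin (j + c + 1))),
          ({z | 0 < MvPolynomial.aeval z (MvPolynomial.X k : MvPolynomial (Fin (j + c + 1)) ℚ)} ∩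
           {z | 0 < MvPolynomial.aeval z
             (MvPolynomial.C 1 - MvPolynomial.X k : MvPolynomial (Fin (j + c + 1)) ℚ)}) := by
      ext z; simp [sub_pos]
    rw [this]
    exact Literature.ModelTheory.ExponentialFields.IsSemialgebraic.biInter _ _ fun k _ =>
      (Literature.ModelTheory.ExponentialFields.isSemialgebraic_setOf_eval_pos _).inter
        (Literature.ModelTheory.ExponentialFields.isSemialgebraic_setOf_eval_pos _)
  have hanti : ∀ {K : ℕ} (g : Fin K → Fin (j + c + 1)),
      Literature.ModelTheory.ExponentialFields.IsSemialgebraic ℚ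
        {z : Fin (j + c + 1) → ℝ | StrictAnti (fun a : Fin K => z (g a))} := by
    intro K g
    have : {z : Fin (j + c + 1) → ℝ | StrictAnti (fun a : Fin K => z (g a))} =
        ⋂ a ∈ (Finset.univ : Finset (Fin K)), ⋂ b ∈ (Finset.univ : Finset (Fin K)),
          (if a < b then {z | 0 < MvPolynomial.aeval z
            (MvPolynomial.X (g a) - MvPolynomial.X (g b) :
              MvPolynomial (Fin (j + c + 1)) ℚ)} else Set.univ) := by
      ext z
      simp only [Set.mem_setOf_eq, Finset.mem_univ, Set.iInter_true, Set.mem_iInter]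
      constructor
      · intro h a b
        split_ifs with hab
        · simpa [sub_pos] using h hab
        · trivial
      · intro h a b hab
        have := h a b
        rw [if_pos hab] at this
        simpa [sub_pos] using this
    rw [this]
    refine Literature.ModelTheory.ExponentialFields.IsSemialgebraic.biInter _ _ fun a _ =>
      Literature.ModelTheory.ExponentialFields.IsSemialgebraic.biInter _ _ fun b _ => ?_
    split_ifs
    · exact Literature.ModelTheory.ExponentialFields.isSemialgebraic_setOf_eval_pos _
    · exact Literature.ModelTheory.ExponentialFields.isSemialgebraic_univ
  have htop : ∀ g : Fin (j + c + 1), Literature.ModelTheory.ExponentialFields.IsSemialgebraic ℚ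
      {z : Fin (j + c + 1) → ℝ | z g < z 0} := fun g => by
    simpa using Literature.ModelTheory.ExponentialFields.isSemialgebraic_setOf_eval_lt (k := ℚ) (R := ℝ)
      (MvPolynomial.X g : MvPolynomial (Fin (j + c + 1)) ℚ) (MvPolynomial.X 0)
  convert (((h1.inter (hanti fun a : Fin j => (Fin.castAdd c a).succ)).inter
    (hanti fun i : Fin c => (Fin.natAdd j i).succ)).inter (htop (Fin.castAdd c ⟨0, hj⟩).succ)).inter
    (htop (Fin.natAdd j ⟨0, hc⟩).succ) using 1
  ext z
  simp only [Set.mem_setOf_eq, Set.mem_inter_iff]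
  tauto

/-- The last letter of a coordinate shuffle of the rider chain and the chain of letters `ε'`
is a rider (letter `1`) or the last letter of `ε'`. [folklore] -/
theorem append_last_of_mem_shuffleWord {j c : ℕ} (hj : 0 < j) (hc : 0 < c) (ε' : Fin c → Bool)
    (hlast : ε' ⟨c - 1, Nat.sub_one_lt_of_lt hc⟩ = true) {e : Fin (j + c) ≃ Fin (j + c)}
    (he : List.ofFn e ∈ MZV.shuffleWord (List.ofFn (Fin.castAdd c : Fin j → Fin (j + c)))
      (List.ofFn (Fin.natAdd j))) :
    Fin.append (fun _ : Fin j => true) ε' (e ⟨j + c - 1, by omega⟩) = true := by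
  have hj1 : j - 1 < j := Nat.sub_one_lt_of_lt hj
  have hc1 : c - 1 < c := Nat.sub_one_lt_of_lt hc
  have hjc1 : j + c - 1 < j + c := by omega
  have h := MZV.getLast?_of_mem_shuffleWord _ _ he
  simp only [List.getLast?_eq_getElem?, List.length_ofFn, List.getElem?_ofFn, hj1, hc1, hjc1,
    dif_pos, Option.some.injEq] at h
  rcases h with h | h
  · rw [h, Fin.append_left]
  · rw [h, Fin.append_right]
    exact hlast

end Summit.KontsevichZagierPeriods.FurushoPentagon.DoubleShuffleInKZ
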